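import Mathlib
import Literature.Analysis.FluidPDE.Tao2016AveragedNS.ShiftSetCascadeFlows
import Summits.NavierStokesRegularity.NavierStokesRegularity.Theorems.TaoLadderRungTwoFlatCertificateGlueCheckerFrameOn
import Summits.NavierStokesRegularity.NavierStokesRegularity.Theorems.TaoLadderRungTwoFlatCertificateGlueCheckerScalarOn
import HarnessLib

/-!
# Certificate glue on a shift set `𝕊`, XXVI: THE STEP CHECKER, LANDING HALF — the five Boolean tests C4–C8 of one Lohner step
  (centre defect, variational bound, frame transport, approximate inverse, E-recursion) ASSEMBLED into the landing-clause
  bundle `LandingClausesAt` of glue XIX-e for the real data denoted by the dyadic tables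
  (helper for items stmt-NavierStokesRegularity-22987 `FlatGapCertificatesV2` (crux K_A♭ of route TaoLadderRungTwoFlat) and
  stmt-24295 K_A₂(64); cell harvest/h2-tao-ladder, p1 g15; CHECKER-SPEC-v3 §3 (iii))

Data conventions (the successor's `WindowStepData` record will carry exactly these): centre `x` read through a box `X ∋ x`
(`Array IntervalD`, point boxes in practice), landing centre `x'`, radii `r`, `r'` (`Array Dyad`), frames `C`, `Cn`, `Cin`
(`Array (Array Dyad)`), scalars `dP NVh κI : Dyad`, `b mC ρC E₀ E₁ h : ℚ`; step length box `H ∋ h`. `Dyad.toRat` bridges the dyadic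
scalars into the exact-rational E-recursion test. `landingClauses_of_checks`: C4 ∧ C5 ∧ C6 ∧ C7 ∧ C8 tests `= true` ⇒
`LandingClausesAt (PQcN …) p b mC ρC E₀ x (dmat C) (dvec r) h (dvec x') (dmat Cn) (dmat Cin) (dvec r') dP NVh κI E₁` — the
`hclauses` input of `stepCert_of_plohner_dense` (with C2/C3/C9 from glue XXV-b/XXV-c and the (B)-table from XXV-e, what remains for
a `StepCert` is δ (`pinputDefectOn_of_table`), `A ≥ gronwallBound` and the node/hull inclusions).

HONEST FRAMING: Tao-type MODEL lattices (Tao 2016 §4/§6 vocabulary, shift-set parametrised); arithmetic soundness lemmas — no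
certificate data, nothing certified, no stub closed, nothing about the Navier–Stokes equations.
-/

-- the sub-problem namespace repeats the summit name by design (D-0017)
set_option linter.dupNamespace false

namespace Summit.NavierStokesRegularity.NavierStokesRegularity.Theorems

open Set Finset Literature.Analysis.FluidPDE Literature.Analysis.FluidPDE.TaoCascade
open Summit.NavierStokesRegularity.NavierStokesRegularity.Theorems.TaylorModelCert
open Summit.NavierStokesRegularity.NavierStokesRegularity.Theorems.TaylorModelReadout

namespace CertificateGlueOn

/-- A dyadic number as an exact rational. [folklore] -/
def dyadToRat (d : Dyad) : ℚ := (d.m : ℚ) * (2 : ℚ) ^ d.e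

/-- The rational value casts to the real value. [folklore] -/
theorem cast_dyadToRat (d : Dyad) : ((dyadToRat d : ℚ) : ℝ) = d.toReal := by
  simp [dyadToRat, Dyad.toReal]

variable {m : ℕ} {Kb Ka : ℤ} {ω : Fin m → ℤ → ℝ} {ε₀ : ℝ} {α : Fin m → Fin m → Fin m → ℤ × ℤ × ℤ → ℝ}
  {shifts : List (ℤ × ℤ × ℤ)} {prec : ℕ} {coefB : Fin m → ℤ → Fin m → Fin m → ℤ × ℤ × ℤ → IntervalD}

/-- **THE LANDING CLAUSES OF ONE STEP FROM THE FIVE TESTS C4–C8** (see the module docstring).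
[cite: Zgliczynski2002C1Lohner, §3–4 (Lohner-type parallelepiped frames and the C¹/variational enclosure); cell certificate format, step checker] -/
theorem landingClauses_of_checks (hKb : 0 ≤ Kb) (hKa : 1 ≤ Ka) (hnd : shifts.Nodup) (hcoef : CoefBoxOK shifts ε₀ α Kb Ka ω coefB)
    (p : ℕ) {X : Array IntervalD} (hX : X.size = m * winLen Kb Ka) {x : Fin (m * winLen Kb Ka) → ℝ}
    (hx : ∀ c < m * winLen Kb Ka, IntervalD.mem (rdN x c) (IntervalD.aget X c)) {H : IntervalD} {h : ℚ}
    (hh : IntervalD.mem (h : ℝ) H) {C Cn Cin : Array (Array Dyad)} {r r' x' : Array Dyad} {dP NVh κI : Dyad}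
    {b mC ρC E₀ E₁ : ℚ}
    (h4 : checkTPoly (m * winLen Kb Ka) prec
      (IntervalD.polyLevelsA (m * winLen Kb Ka) prec
        (IntervalD.jetLevelsA (m * winLen Kb Ka) (pqBoxA Kb Ka prec shifts coefB) prec X p) p H) x' dP = true)
    (h5 : checkNVh (m * winLen Kb Ka)
      (IntervalD.polyLevelsA (m * winLen Kb Ka) prec
        (IntervalD.varJetLevelsA (m * winLen Kb Ka) (pqBoxA Kb Ka prec shifts coefB) prec
          (IntervalD.jetLevelsA (m * winLen Kb Ka) (pqBoxA Kb Ka prec shifts coefB) prec X p)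
          (unitBoxA (m * winLen Kb Ka)) p) p H) NVh = true)
    (h6 : checkFrame (m * winLen Kb Ka)
      (pcolsA prec (m * winLen Kb Ka) Cin (vcolsA Kb Ka prec shifts coefB p
        (IntervalD.jetLevelsA (m * winLen Kb Ka) (pqBoxA Kb Ka prec shifts coefB) prec X p) H C)) r r' = true)
    (h7 : checkKappa prec (m * winLen Kb Ka) Cn
      (pcolsA prec (m * winLen Kb Ka) Cin (vcolsA Kb Ka prec shifts coefB p
        (IntervalD.jetLevelsA (m * winLen Kb Ka) (pqBoxA Kb Ka prec shifts coefB) prec X p) H C))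
      (vcolsA Kb Ka prec shifts coefB p
        (IntervalD.jetLevelsA (m * winLen Kb Ka) (pqBoxA Kb Ka prec shifts coefB) prec X p) H C) r κI = true)
    (h8 : checkERec p b mC ρC E₀ (dyadToRat κI) (dyadToRat dP) (dyadToRat NVh) h E₁ = true) :
    LandingClausesAt (PQcN shifts.toFinset ε₀ α Kb Ka ω) p (b : ℝ) mC ρC E₀ x (dmat (n := m * winLen Kb Ka) C)
      (dvec (n := m * winLen Kb Ka) r) (h : ℝ) (dvec (n := m * winLen Kb Ka) x') (dmat (n := m * winLen Kb Ka) Cn)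
      (dmat (n := m * winLen Kb Ka) Cin) (dvec (n := m * winLen Kb Ka) r') dP.toReal NVh.toReal κI.toReal (E₁ : ℝ) := by
  refine ⟨?_, ?_, ?_, ?_, ?_⟩
  · -- C4
    exact abs_TPoly_sub_le_of_checkTPoly hKb hKa hnd hcoef p hX hx hh h4
  · -- C5
    exact abs_VPoly_le_of_checkNVh hKb hKa hnd hcoef p hX hx hh h5
  · -- C6
    exact frame_of_checkFrame hKb hKa hnd hcoef p hX hx hh h6
  · -- C7
    exact kappa_of_checkKappa hKb hKa hnd hcoef p hX hx hh h7
  · -- C8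
    have h := eRec_of_check h8
    simp only [cast_dyadToRat] at h
    exact h

end CertificateGlueOn

end Summit.NavierStokesRegularity.NavierStokesRegularity.Theorems
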